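import Mathlib
import Summits.Parity.BatemanHorn.Theorems.IsogenyRedeiTypeIMainTermNormBounds
import HarnessLib

/-!
# Type-I main term for Bateman–Horn (stmt-Parity-0873), input B3 (part 4):
# `∑_n ‖𝓮(n)‖ < ∞`

* `sum_le_prod_tsum_of_submultiplicative` — Euler-product majorant for a nonnegative function
  that is *sub*-multiplicative on coprime arguments (via the multiplicative majorant
  `n ↦ ∏_{p^v ∥ n} h(p^v)` and Hall–Tenenbaum (0.4), the tree's `HallTenenbaum.sum_div_le_prod_tsum`);
* `summable_norm1_eFun` — for a Bateman–Horn system `f`, `∑_n ‖𝓮(n)‖_{ℓ¹} < ∞`: the local series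
  converge at every prime (`norm1_eFun_prime_pow_le`, ratio `1 − 1/p`), `𝓮(p) = 0`, and at the
  good primes `p ≥ P₁` the local series beyond the constant term is `≪ (1 + log p)^{k+1}/p²`
  (`norm1_eFun_prime_pow_le_of_good`).

Everything here is proved.
-/

noncomputable section

open Finset Polynomial ArithmeticFunction
open scoped ArithmeticFunction.Moebius

namespace Summit.Parity.BatemanHorn.Theorems.TypeIMainTerm

open Literature.NumberTheory.Sieve Literature.NumberTheory.LFunctions

variable {k : ℕ}

/-! ### The Euler-product majorant for sub-multiplicative functions -/

/-- **Euler-product majorant.** If `h ≥ 0`, `h(1) = 1`, `h(0) ≤ 1`, `h(mn) ≤ h(m)h(n)` for coprime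
`m, n > 1`, and every local series `∑_v h(p^v)` converges, then
`∑_{n ≤ X} h(n) ≤ ∏_{p ≤ X} ∑_v h(p^v)`. [folklore] -/
theorem sum_le_prod_tsum_of_submultiplicative (h : ℕ → ℝ) (h0 : ∀ n, 0 ≤ h n) (h1 : h 1 = 1)
    (h0zero : h 0 ≤ 1)
    (hsub : ∀ m n, 1 < m → 1 < n → Nat.Coprime m n → h (m * n) ≤ h m * h n)
    (hloc : ∀ p, p.Prime → Summable (fun v => h (p ^ v))) (X : ℕ) :
    ∑ n ∈ Icc 1 X, h n ≤ ∏ p ∈ Nat.primesLE X, ∑' v, h (p ^ v) := by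
  -- the multiplicative majorant
  set F : ℕ → ℝ := fun n => n.factorization.prod fun p v => h (p ^ v) with hF
  have hF1 : F 1 = 1 := by simp [hF]
  have hFpow : ∀ p v : ℕ, p.Prime → F (p ^ v) = h (p ^ v) := by
    intro p v hp
    rcases Nat.eq_zero_or_pos v with rfl | hv
    · simp [hF, h1]
    · simp only [hF]
      rw [hp.factorization_pow, Finsupp.prod_single_index (by simp [h1])]
  have hFmul : ∀ m n : ℕ, Nat.Coprime m n → F (m * n) = F m * F n := by
    intro m n hmn
    rcases eq_or_ne m 0 with rfl | hm
    · simp only [Nat.coprime_zero_left] at hmn; subst hmn; simp [hF]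
    rcases eq_or_ne n 0 with rfl | hn
    · simp only [Nat.coprime_zero_right] at hmn; subst hmn; simp [hF]
    simp only [hF]
    rw [Nat.factorization_mul hm hn, Finsupp.prod_add_index_of_disjoint]
    rw [Nat.support_factorization, Nat.support_factorization]
    exact hmn.disjoint_primeFactors
  have hF0 : ∀ n, 0 ≤ F n := fun n => Finset.prod_nonneg fun p _ => h0 _
  have hle : ∀ n, h n ≤ F n := by
    intro n
    induction n using Nat.recOnPosPrimePosCoprime with
    | prime_pow p v hp hv => rw [hFpow p v hp]
    | zero =>
      simp only [hF, Nat.factorization_zero, Finsupp.prod_zero_index]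
      exact h0zero
    | one => rw [h1, hF1]
    | coprime a b ha hb hab iha ihb =>
      rw [hFmul a b hab]
      exact (hsub a b ha hb hab).trans (mul_le_mul iha ihb (h0 b) (hF0 a))
  -- Hall–Tenenbaum (0.4) for `n F(n)`
  set G : ℕ → ℝ := fun n => n * F n with hG
  have hG1 : G 1 = 1 := by simp [hG, hF1]
  have hGmul : ∀ m n, Nat.Coprime m n → G (m * n) = G m * G n := by
    intro m n hmn; simp only [hG]; rw [hFmul m n hmn]; push_cast; ring
  have hG0 : ∀ n, 0 ≤ G n := fun n => mul_nonneg (Nat.cast_nonneg n) (hF0 n)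
  have hGloc : ∀ p : ℕ, p.Prime → Summable (fun v : ℕ => G (p ^ v) / (p : ℝ) ^ v) := by
    intro p hp
    have hp0 : (p : ℝ) ≠ 0 := by exact_mod_cast hp.ne_zero
    refine (hloc p hp).congr fun v => ?_
    simp only [hG]; rw [hFpow p v hp]; push_cast; field_simp
  have key := HallTenenbaum.sum_div_le_prod_tsum hG1 hGmul hG0 hGloc X
  have hlhs : ∑ n ∈ Icc 1 X, G n / n = ∑ n ∈ Icc 1 X, F n := by
    refine Finset.sum_congr rfl fun n hn => ?_
    have hn0 : (n : ℝ) ≠ 0 := by exact_mod_cast (Nat.one_le_iff_ne_zero.mp (Finset.mem_Icc.mp hn).1)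
    simp only [hG]; field_simp
  have hrhs : ∀ p ∈ Nat.primesLE X, ∑' v : ℕ, G (p ^ v) / (p : ℝ) ^ v = ∑' v, h (p ^ v) := by
    intro p hp
    have hp' := Nat.prime_of_mem_primesLE hp
    have hp0 : (p : ℝ) ≠ 0 := by exact_mod_cast hp'.ne_zero
    refine tsum_congr fun v => ?_
    simp only [hG]; rw [hFpow p v hp']; push_cast; field_simp
  rw [hlhs, Finset.prod_congr rfl hrhs] at key
  exact (Finset.sum_le_sum fun n _ => hle n).trans key


/-! ### Two real-variable lemmas -/

/-- `(1 + log x)^m ≤ (1 + 2m)^m √x` for `x ≥ 1`, `m ≥ 1`. -/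
theorem one_add_log_pow_le_sqrt {m : ℕ} (hm : 1 ≤ m) {x : ℝ} (hx : 1 ≤ x) :
    (1 + Real.log x) ^ m ≤ (1 + 2 * (m : ℝ)) ^ m * Real.sqrt x := by
  have hx0 : 0 ≤ x := by linarith
  set ε : ℝ := 1 / (2 * m) with hε
  have hm0 : (0 : ℝ) < m := by exact_mod_cast hm
  have hε0 : 0 < ε := by positivity
  have hlog : Real.log x ≤ 2 * m * x ^ ε := by
    have h := Real.log_le_rpow_div hx0 hε0
    have e : x ^ ε / ε = 2 * m * x ^ ε := by rw [hε]; field_simp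
    linarith [h, e.le, e.ge]
  have hxε : 1 ≤ x ^ ε := Real.one_le_rpow hx hε0.le
  have h1 : 1 + Real.log x ≤ (1 + 2 * m) * x ^ ε := by nlinarith
  have h0 : 0 ≤ 1 + Real.log x := by have := Real.log_nonneg hx; linarith
  calc (1 + Real.log x) ^ m ≤ ((1 + 2 * m) * x ^ ε) ^ m := pow_le_pow_left₀ h0 h1 m
    _ = (1 + 2 * (m : ℝ)) ^ m * (x ^ ε) ^ m := mul_pow _ _ _
    _ = (1 + 2 * (m : ℝ)) ^ m * Real.sqrt x := by
        rw [← Real.rpow_natCast (x ^ ε) m, ← Real.rpow_mul hx0, hε, Real.sqrt_eq_rpow]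
        congr 2
        field_simp

/-- `∑_p (1 + log p)^m / p² < ∞`. -/
theorem summable_primes_one_add_log_pow_div_sq (m : ℕ) :
    Summable (fun p : Nat.Primes => (1 + Real.log p) ^ m / ((p : ℕ) : ℝ) ^ 2) := by
  set m' := max m 1 with hm'
  have hm'1 : 1 ≤ m' := le_max_right _ _
  have hs : Summable (fun p : Nat.Primes => (1 + 2 * (m' : ℝ)) ^ m' * ((p : ℕ) : ℝ) ^ (-(3 / 2 : ℝ))) :=
    (Nat.Primes.summable_rpow.mpr (by norm_num)).mul_left _
  refine Summable.of_nonneg_of_le (fun p => by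
    have : 0 ≤ Real.log ((p : ℕ) : ℝ) := Real.log_nonneg (by exact_mod_cast p.2.one_lt.le)
    positivity) (fun p => ?_) hs
  have hp1 : (1 : ℝ) ≤ (p : ℕ) := by exact_mod_cast p.2.one_lt.le
  have hp0 : (0 : ℝ) < (p : ℕ) := by linarith
  have hlog0 : 0 ≤ Real.log ((p : ℕ) : ℝ) := Real.log_nonneg hp1
  have h1 : (1 + Real.log ((p : ℕ) : ℝ)) ^ m ≤ (1 + Real.log ((p : ℕ) : ℝ)) ^ m' :=
    pow_le_pow_right₀ (by linarith) (le_max_left _ _)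
  have h2 := one_add_log_pow_le_sqrt hm'1 hp1
  rw [div_le_iff₀ (by positivity)]
  calc (1 + Real.log ((p : ℕ) : ℝ)) ^ m ≤ (1 + 2 * (m' : ℝ)) ^ m' * Real.sqrt ((p : ℕ) : ℝ) := h1.trans h2
    _ = (1 + 2 * (m' : ℝ)) ^ m' * ((p : ℕ) : ℝ) ^ (-(3 / 2 : ℝ)) * ((p : ℕ) : ℝ) ^ 2 := by
        rw [Real.sqrt_eq_rpow, mul_assoc]
        congr 1
        rw [← Real.rpow_natCast _ 2, ← Real.rpow_add hp0]
        norm_num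

/-! ### Local summability of `‖𝓮(p^v)‖` -/

variable (f : Fin k → ℤ[X])

/-- `g_i(p) ≤ 1 − 1/p` when `ρ_{f_i}(p) < p`. -/
theorem rootDensity_le_one_sub_inv {i : Fin k} {p : ℕ} (hp : p.Prime)
    (hρ : polyRootCountMod ![f i] p < p) : rootDensity (f i) p ≤ 1 - 1 / (p : ℝ) := by
  have hp0 : (0 : ℝ) < p := by exact_mod_cast hp.pos
  rw [rootDensity_apply, div_le_iff₀ hp0, sub_mul, one_mul, div_mul_cancel₀ _ hp0.ne']
  have : (polyRootCountMod ![f i] p : ℝ) + 1 ≤ p := by exact_mod_cast hρ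
  linarith

/-- **Every local series `∑_v ‖𝓮(p^v)‖` converges** (ratio `1 − 1/p < 1`). -/
theorem summable_norm1_eFun_prime_pow (hρ : ∀ i p, p.Prime → polyRootCountMod ![f i] p < p)
    {p : ℕ} (hp : p.Prime) : Summable (fun v : ℕ => SAlg.norm1 (eFun f (p ^ v))) := by
  set γ : ℝ := 1 - 1 / (p : ℝ) with hγ
  have hp2 : (2 : ℝ) ≤ p := by exact_mod_cast hp.two_le
  have hp0 : (0 : ℝ) < p := by linarith
  have hγ0 : 0 < γ := by
    rw [hγ, sub_pos, div_lt_one hp0]; linarith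
  have hγ1 : γ < 1 := by
    have : 0 < 1 / (p : ℝ) := by positivity
    simp only [hγ]; linarith
  have hγi : ∀ i, rootDensity (f i) p ≤ γ := fun i => rootDensity_le_one_sub_inv f hp (hρ i p hp)
  have hlog : 0 ≤ Real.log p := Real.log_nonneg (by linarith)
  set C : ℝ := ((k : ℝ) + 1) * (1 + Real.log p) ^ (2 * k) * (γ⁻¹) ^ k with hC
  refine Summable.of_nonneg_of_le (fun v => SAlg.norm1_nonneg _)
    (fun v => (norm1_eFun_prime_pow_le f hp hγ0.le hγ1.le hγi v).trans ?_)
    ((Literature.Analysis.ODE.summable_succ_pow_mul_geometric (4 * k) hγ0.le hγ1).mul_left C)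
  -- `(k+1)(v+1)^{2k}(1 + v log p)^{2k} γ^{v-k} ≤ C (v+1)^{4k} γ^v`
  have h1 : (1 + v * Real.log p) ^ (2 * k) ≤ ((v : ℝ) + 1) ^ (2 * k) * (1 + Real.log p) ^ (2 * k) := by
    rw [← mul_pow]; exact pow_le_pow_left₀ (by positivity) (by nlinarith) _
  have h2 : γ ^ (v - k) ≤ γ ^ v * (γ⁻¹) ^ k := by
    rw [inv_pow, ← div_eq_mul_inv, le_div_iff₀ (pow_pos hγ0 k)]
    rcases le_or_gt k v with hkv | hkv
    · rw [← pow_add, Nat.sub_add_cancel hkv]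
    · rw [Nat.sub_eq_zero_of_le hkv.le, pow_zero, one_mul]
      exact pow_le_pow_of_le_one hγ0.le hγ1.le hkv.le
  calc ((k : ℝ) + 1) * (((v : ℝ) + 1) ^ (2 * k) * (1 + v * Real.log p) ^ (2 * k) * γ ^ (v - k))
      ≤ ((k : ℝ) + 1) * (((v : ℝ) + 1) ^ (2 * k) * (((v : ℝ) + 1) ^ (2 * k) * (1 + Real.log p) ^ (2 * k))
          * (γ ^ v * (γ⁻¹) ^ k)) := by gcongr
    _ = C * (((v : ℝ) + 1) ^ (4 * k) * γ ^ v) := by rw [hC]; ring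

/-- `𝓮(1) = 1` and `‖𝓮(1)‖ = 1`, `‖𝓮(p)‖ = 0`. -/
theorem norm1_eFun_one : SAlg.norm1 (eFun f 1) = 1 := by
  rw [(isMultiplicative_eFun f).map_one, SAlg.norm1_one]

/-- **The local series at a good prime `p ≥ 2B`:**
`∑_v ‖𝓮(p^v)‖ ≤ 1 + (k+1) M_k B² (1 + log p)^{k+1}/p²`. -/
theorem tsum_norm1_eFun_prime_pow_le_of_good (hρ : ∀ i p, p.Prime → polyRootCountMod ![f i] p < p)
    {B : ℝ} (hB0 : 0 ≤ B) (hB : ∀ i p, p.Prime → (polyRootCountMod ![f i] p : ℝ) ≤ B) {p : ℕ}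
    (hp : p.Prime)
    (hgood : ∀ i i' : Fin k, i ≠ i' → ∀ n : ℕ,
      ¬(((p : ℕ) : ℤ) ∣ (f i).eval (n : ℤ) ∧ ((p : ℕ) : ℤ) ∣ (f i').eval (n : ℤ)))
    (hpB : 2 * B ≤ p) :
    ∑' v : ℕ, SAlg.norm1 (eFun f (p ^ v)) ≤
      1 + ((k : ℝ) + 1) * (∑' u : ℕ, ((u : ℝ) + 3) ^ (2 * k + 1) * (1 / 2 : ℝ) ^ u) *
        (B ^ 2 / (p : ℝ) ^ 2) * (1 + Real.log p) ^ (k + 1) := by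
  have hsum := summable_norm1_eFun_prime_pow f hρ hp
  have hp2 : (2 : ℝ) ≤ p := by exact_mod_cast hp.two_le
  have hp0 : (0 : ℝ) < p := by linarith
  have hlog : 0 ≤ Real.log p := Real.log_nonneg (by linarith)
  set γ : ℝ := B / p with hγ
  have hγ0 : 0 ≤ γ := by positivity
  have hγi : ∀ i, rootDensity (f i) p ≤ γ := fun i => by
    rw [rootDensity_apply, hγ]; exact div_le_div_of_nonneg_right (hB i p hp) hp0.le
  have hγhalf : γ ≤ 1 / 2 := by
    rw [hγ, div_le_iff₀ hp0]; linarith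
  -- the polynomial–geometric constant
  set Mk : ℝ := ∑' u : ℕ, ((u : ℝ) + 3) ^ (2 * k + 1) * (1 / 2 : ℝ) ^ u with hMk
  have hMs : Summable (fun u : ℕ => ((u : ℝ) + 3) ^ (2 * k + 1) * (1 / 2 : ℝ) ^ u) := by
    have h3 := (Literature.Analysis.ODE.summable_succ_pow_mul_geometric (2 * k + 1) (by norm_num : (0:ℝ) ≤ 1 / 2)
      (by norm_num)).mul_left ((3 : ℝ) ^ (2 * k + 1))
    refine Summable.of_nonneg_of_le (fun u => by positivity) (fun u => ?_) h3
    rw [← mul_assoc, ← mul_pow]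
    gcongr
    linarith
  rw [← hsum.sum_add_tsum_nat_add 2, Finset.sum_range_succ, Finset.sum_range_one, pow_zero,
    norm1_eFun_one, pow_one, eFun_prime f hp, SAlg.norm1_zero, add_zero]
  have hshift : Summable (fun v : ℕ => SAlg.norm1 (eFun f (p ^ (v + 2)))) :=
    (summable_nat_add_iff (f := fun v : ℕ => SAlg.norm1 (eFun f (p ^ v))) 2).mpr hsum
  have hmaj : ∀ v : ℕ, SAlg.norm1 (eFun f (p ^ (v + 2))) ≤
      ((k : ℝ) + 1) * (1 + Real.log p) ^ (k + 1) * γ ^ 2 * (((v : ℝ) + 3) ^ (2 * k + 1) * (1 / 2 : ℝ) ^ v) := by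
    intro v
    refine (norm1_eFun_prime_pow_le_of_good f hp hgood hγ0 hγi (v := v + 2) (by omega)).trans ?_
    have e1 : ((v + 2 : ℕ) : ℝ) = v + 2 := by push_cast; ring
    rw [e1]
    have h1 : (1 + ((v : ℝ) + 2) * Real.log p) ^ (k + 1) ≤ ((v : ℝ) + 3) ^ (k + 1) * (1 + Real.log p) ^ (k + 1) := by
      rw [← mul_pow]; exact pow_le_pow_left₀ (by positivity) (by nlinarith) _
    have h2 : γ ^ (v + 2) ≤ γ ^ 2 * (1 / 2 : ℝ) ^ v := by
      rw [show v + 2 = 2 + v by ring, pow_add]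
      exact mul_le_mul_of_nonneg_left (pow_le_pow_left₀ hγ0 hγhalf v) (by positivity)
    have h3 : ((v : ℝ) + 2 + 1) ^ k = ((v : ℝ) + 3) ^ k := by ring
    calc ((k : ℝ) + 1) * (((v : ℝ) + 2 + 1) ^ k * (1 + ((v : ℝ) + 2) * Real.log p) ^ (k + 1) * γ ^ (v + 2))
        ≤ ((k : ℝ) + 1) * (((v : ℝ) + 3) ^ k * (((v : ℝ) + 3) ^ (k + 1) * (1 + Real.log p) ^ (k + 1)) *
            (γ ^ 2 * (1 / 2 : ℝ) ^ v)) := by rw [h3]; gcongr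
      _ = ((k : ℝ) + 1) * (1 + Real.log p) ^ (k + 1) * γ ^ 2 *
            (((v : ℝ) + 3) ^ (2 * k + 1) * (1 / 2 : ℝ) ^ v) := by ring
  have hfin : ∑' v : ℕ, SAlg.norm1 (eFun f (p ^ (v + 2))) ≤
      ((k : ℝ) + 1) * Mk * (B ^ 2 / (p : ℝ) ^ 2) * (1 + Real.log p) ^ (k + 1) :=
    calc ∑' v : ℕ, SAlg.norm1 (eFun f (p ^ (v + 2)))
        ≤ ∑' v : ℕ, ((k : ℝ) + 1) * (1 + Real.log p) ^ (k + 1) * γ ^ 2 *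
            (((v : ℝ) + 3) ^ (2 * k + 1) * (1 / 2 : ℝ) ^ v) :=
          Summable.tsum_le_tsum hmaj hshift (hMs.mul_left _)
      _ = ((k : ℝ) + 1) * Mk * (B ^ 2 / (p : ℝ) ^ 2) * (1 + Real.log p) ^ (k + 1) := by
          rw [tsum_mul_left, ← hMk, hγ, div_pow]; ring
  linarith
end Summit.Parity.BatemanHorn.Theorems.TypeIMainTerm

end
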